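import Literature.MathematicalPhysics.QuantumFieldTheory.Dimock2011to13.QED3TwoSpeciesKernels
import Mathlib.Data.Matrix.PEquiv
import Mathlib.LinearAlgebra.Matrix.Permutation
import HarnessLib

/-!
# Dimock, *Ultraviolet stability for QED in d = 3*, §4.2.1 LEMMA 20 proof, the sentence after (451):
# the unit Gaussian `dμ_I` integrates every basis monomial to `0` or `±1` — PROVED (the `|∫θ_T dμ_I| ≤ 1` input of the
# integration step (452), `QED3LargeFieldFermion.lemma20_step`'s hypothesis `hμ`, discharged)

Topic `Literature/MathematicalPhysics/QuantumFieldTheory/Dimock2011to13`; sibling of `QED3TwoSpeciesKernels.lean` ((305)–(312)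
of the 3-torus paper I App. B: charged covariances `IsChargedCov`, `twoPoint`, the determinant rule
`gaussExpect_genProd_pairTuple_eq_det`, the selection rule `gaussExpect_genProd_pairTuple_eq_zero`) and of
`QED3LargeFieldFermionIntegration.lean` (LEMMA 20's integration step (452)∕(455), `lemma20_step (μ) (hμ : ∀ T, ‖μ(θ_T)‖ ≤ 1)`).

statement-level skeleton of published theorems with citation tags; proofs where landed; nothing here is a claim about the Yang–Mills mass gap

**The printed sentence.**  J. Dimock, *Ultraviolet stability for QED in d = 3*, Ann. Henri Poincaré **23** (2022) 2113–2205
(= arXiv:2009.01156v2) [Dimock2022UVStabilityQED3], §4.2.1 LEMMA 20 proof, p.61 L30–58 of the held text layer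
`paper:arxiv-2009.01156`: *"To facilitate estimates we artificially introduce a Gaussian integral by
`DΨ′_{K,Ω_K} = e^{⟨Ψ̄′_K,Ψ′_K⟩_{Ω_K}}dμ_I(Ψ′_K)`. Then we have … (451) … Now we estimate as before … the integral over
`Ψ′_{K,Ω_K}` is estimated by lemma 22 in [30] (with weight 1 for the unit covariance) …"* — the step uses that the unit
Gaussian integral has `|∫ (monomial) dμ_I| ≤ 1`, the property carried as the hypothesis
`hμ : ∀ T, ‖μ (grassmannBasis 𝕜 ι₂ T)‖ ≤ 1` of `QED3LargeFieldFermion.lemma20_step` ("for `μ` with `|μ(θ′_T)| ≤ 1` (unit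
Gaussian)").  Here that property is PROVED for every charged Gaussian whose two-point function is `c·δ` with `‖c‖ ≤ 1`
(the unit covariance: `c = ±1` according to orientation).

**What is formalised.**  On the two-species algebra `Λ(X ⊕ₗ X)` over an `RCLike` field `𝕜`:
* §1 **`norm_det_indicator_le_one`** — for injective `x, y : Fin n → X` the `0∕1` matrix `[x_i = y_j]` has at most one `1`
  per row and column, hence determinant `0` or `±1` (a zero row, or a permutation matrix: `Matrix.det_permutation`);
  **`norm_det_indicator_smul_le_one`** — with entries `c·[x_i = y_j]`, `‖c‖ ≤ 1`: `‖det‖ ≤ 1`.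
* §2 **`grassmannBasis_eq_genProd_pairTuple`** — every basis monomial `θ_S` of `Λ(X ⊕ₗ X)` is the block-ordered product
  `Ψ(x₁)⋯Ψ(x_n)Ψ̄(x̄₁)⋯Ψ̄(x̄_m)` of the increasing enumerations of its two blocks ((305)∕(315) of the 3-torus paper I).
* §3 **`norm_gaussExpect_grassmannBasis_le_one`** — for a charged covariance `C` (`IsChargedCov C`) with two-point function
  `twoPoint C x y = c·[x = y]`, `‖c‖ ≤ 1`: `‖∫ θ_S dμ_C‖ ≤ 1` for EVERY `S` (selection rule for unequal charges, (309) and §1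
  otherwise) — the hypothesis `hμ` of `lemma20_step` for such `μ = ∫·dμ_C`.

**Scope ∕ reading.**  Finite index sets; the identification of Dimock's `dμ_I` with a `gaussExpect 𝕜 C` of this kind is the
two-species dictionary (`∫ψψ̄ dμ_I = ±δ`, charge conservation); nothing about `d = 4`.
-/

noncomputable section

namespace Literature.MathematicalPhysics.QuantumFieldTheory.Dimock2011to13

namespace QED3TorusI

open Finset Literature.MathematicalPhysics.QuantumLattice Literature.MathematicalPhysics.QuantumLattice.GrassmannAlgebra

variable {𝕜 : Type*} [RCLike 𝕜] {X : Type*}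

/-! ## §1 Determinants of `0∕1` matrices with at most one `1` per row and column -/

section Indicator

variable [DecidableEq X]

/-- The `0∕1` matrix `[x_i = y_j]`. [cite: Dimock2022UVStabilityQED3, §4.2.1 Lemma 20 proof (451)–(452) p.61 L30–58] -/
def indicatorMatrix {n : ℕ} (x y : Fin n → X) : Matrix (Fin n) (Fin n) 𝕜 :=
  Matrix.of fun i j => if x i = y j then 1 else 0

/-- Unfolding. [cite: Dimock2022UVStabilityQED3, §4.2.1 Lemma 20 proof (451)–(452) p.61 L30–58] -/
theorem indicatorMatrix_apply {n : ℕ} (x y : Fin n → X) (i j : Fin n) :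
    indicatorMatrix (𝕜 := 𝕜) x y i j = if x i = y j then 1 else 0 := rfl

/-- **The determinant of `[x_i = y_j]` for injective `x`, `y` is `0` or `±1`**: either some `x_i` is not a value of `y` (a
zero row), or `i ↦` the unique `j` with `y_j = x_i` is a permutation `σ` and the matrix is the permutation matrix of `σ`.
[cite: Dimock2022UVStabilityQED3, §4.2.1 Lemma 20 proof (451)–(452) p.61 L30–58] -/
theorem norm_det_indicator_le_one {n : ℕ} {x y : Fin n → X} (hx : Function.Injective x) (hy : Function.Injective y) :
    ‖(indicatorMatrix (𝕜 := 𝕜) x y).det‖ ≤ 1 := by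
  classical
  by_cases h : ∀ i, ∃ j, y j = x i
  · -- a permutation matrix
    choose σf hσf using h
    have hσinj : Function.Injective σf := by
      intro i i' hii'
      apply hx
      rw [← hσf i, ← hσf i', hii']
    let σ : Equiv.Perm (Fin n) := Equiv.ofBijective σf (Finite.injective_iff_bijective.mp hσinj)
    have hσ : ∀ i, (σ i : Fin n) = σf i := fun i => rfl
    have hmat : indicatorMatrix (𝕜 := 𝕜) x y = (Equiv.toPEquiv σ).toMatrix := by
      ext i j
      have hiff : (x i = y j) ↔ (j ∈ some (σ i)) := by
        rw [Option.mem_some_iff, hσ]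
        exact ⟨fun hij => hy ((hσf i).trans hij), fun h => by rw [← h, hσf]⟩
      simp only [indicatorMatrix_apply, PEquiv.toMatrix_apply, Equiv.toPEquiv_apply, hiff]
      congr
    rw [hmat, Matrix.det_permutation]
    rcases Int.units_eq_one_or (Equiv.Perm.sign σ) with h1 | h1 <;> simp [h1]
  · -- a zero row
    obtain ⟨i, hi⟩ := not_forall.mp h
    rw [Matrix.det_eq_zero_of_row_eq_zero i (fun j => ?_), norm_zero]
    · exact zero_le_one
    · rw [indicatorMatrix_apply, if_neg (fun h' => hi ⟨j, h'.symm⟩)]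

/-- With entries `c·[x_i = y_j]`, `‖c‖ ≤ 1`: `‖det‖ = ‖c‖^n·‖det[x_i = y_j]‖ ≤ 1`.
[cite: Dimock2022UVStabilityQED3, §4.2.1 Lemma 20 proof (451)–(452) p.61 L30–58] -/
theorem norm_det_indicator_smul_le_one {n : ℕ} {x y : Fin n → X} (hx : Function.Injective x)
    (hy : Function.Injective y) {c : 𝕜} (hc : ‖c‖ ≤ 1) :
    ‖(Matrix.of fun i j => if x i = y j then c else (0 : 𝕜)).det‖ ≤ 1 := by
  have hM : (Matrix.of fun i j => if x i = y j then c else (0 : 𝕜)) = c • indicatorMatrix x y := by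
    ext i j
    rw [Matrix.of_apply, Matrix.smul_apply, indicatorMatrix_apply, smul_eq_mul, mul_ite, mul_one, mul_zero]
  rw [hM, Matrix.det_smul, norm_mul, norm_pow, Fintype.card_fin]
  exact mul_le_one₀ (pow_le_one₀ (norm_nonneg _) hc) (norm_nonneg _) (norm_det_indicator_le_one hx hy)

end Indicator

/-! ## §2 Basis monomials of `Λ(X ⊕ₗ X)` in block order -/

section Basis

variable {ι₁ ι₂ : Type*} [LinearOrder ι₁] [Fintype ι₁] [LinearOrder ι₂] [Fintype ι₂]

/-- **`θ_S = Ψ(x₁)⋯Ψ(x_n)Ψ̄(x̄₁)⋯Ψ̄(x̄_m)`** with `x`, `x̄` the increasing enumerations of the two blocks `fstPart S`, `sndPart S`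
of the letters — every basis monomial is a block-ordered product (no sign: all `Ψ`-letters precede all `Ψ̄`-letters in
`ι₁ ⊕ₗ ι₂`). [cite: Dimock2002QED3TorusI, App. B (305)–(306) p.63 L3–27, (315) p.64 L13–17] -/
theorem grassmannBasis_eq_genProd_pairTuple (S : Finset (ι₁ ⊕ₗ ι₂)) {n m : ℕ} (hn : (fstPart S).card = n)
    (hm : (sndPart S).card = m) :
    grassmannBasis 𝕜 (ι₁ ⊕ₗ ι₂) S =
      genProd 𝕜 (pairTuple (fun i => (fstPart S).orderEmbOfFin hn i) (fun j => (sndPart S).orderEmbOfFin hm j)) := by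
  rw [genProd_pairTuple, ← grassmannBasis_eq_genProd_of_card, ← grassmannBasis_eq_genProd_of_card,
    grassmannBasis_map_union, map_fstPart_union_map_sndPart]

end Basis

/-! ## §3 `|∫ θ_S dμ_I| ≤ 1`: the unit (charged, diagonal) Gaussian on basis monomials -/

section UnitGaussian

variable [LinearOrder X] [Fintype X]

/-- **The unit Gaussian integrates basis monomials to numbers of modulus `≤ 1`** — the property *"`|μ(θ′_T)| ≤ 1` (unit
Gaussian)"* required of `μ` by `QED3LargeFieldFermion.lemma20_step`, PROVED for every charged covariance `C` on `X ⊕ₗ X`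
(`IsChargedCov C`: no `ΨΨ`, `Ψ̄Ψ̄` contractions) whose two-point function is diagonal with a coefficient of modulus `≤ 1`,
`∫ Ψ(x)Ψ̄(y) dμ_C = c·[x = y]`, `‖c‖ ≤ 1` (Dimock's `dμ_I`: `c = ±1` by orientation): for every set of letters `S`,
`‖∫ θ_S dμ_C‖ ≤ 1`.  Proof: `θ_S = Ψ(x)Ψ̄(x̄)` in block order (§2); unequal block sizes integrate to `0` (charge selection,
`gaussExpect_genProd_pairTuple_eq_zero`); equal sizes give `σ_n det{c[x_i = x̄_j]}` ((309)∕(312),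
`gaussExpect_genProd_pairTuple_eq_det`), of modulus `≤ 1` by §1. [cite: Dimock2022UVStabilityQED3, §4.2.1 Lemma 20 proof
(451)–(452) p.61 L30–58; Dimock2002QED3TorusI, App. B (309), (312) p.63–64] -/
theorem norm_gaussExpect_grassmannBasis_le_one {C : Matrix (X ⊕ₗ X) (X ⊕ₗ X) 𝕜} (hC : IsChargedCov C) {c : 𝕜}
    (hc : ‖c‖ ≤ 1) (htp : ∀ x y : X, twoPoint C x y = if x = y then c else 0) (S : Finset (X ⊕ₗ X)) :
    ‖gaussExpect 𝕜 C (grassmannBasis 𝕜 (X ⊕ₗ X) S)‖ ≤ 1 := by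
  classical
  by_cases hnm : (fstPart S).card = (sndPart S).card
  · -- equal charges: the determinant rule (309)∕(312) and §1
    rw [grassmannBasis_eq_genProd_pairTuple S hnm rfl, gaussExpect_genProd_pairTuple_eq_det hC, norm_mul, norm_pow,
      norm_neg, norm_one, one_pow, one_mul]
    simp only [htp]
    exact norm_det_indicator_smul_le_one ((fstPart S).orderEmbOfFin hnm).injective
      ((sndPart S).orderEmbOfFin rfl).injective hc
  · -- unequal charges integrate to zero
    rw [grassmannBasis_eq_genProd_pairTuple S rfl rfl, gaussExpect_genProd_pairTuple_eq_zero hC hnm, norm_zero]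
    exact zero_le_one

/-- **The hypothesis `hμ` of `QED3LargeFieldFermion.lemma20_step`, discharged** for `μ = ∫·dμ_C`, `C` charged with diagonal
two-point function of modulus `≤ 1`: `∀ T, ‖μ(θ_T)‖ ≤ 1`. [cite: Dimock2022UVStabilityQED3, §4.2.1 Lemma 20 proof (451)–(452)
p.61 L30–58] -/
theorem unitGaussian_hμ {C : Matrix (X ⊕ₗ X) (X ⊕ₗ X) 𝕜} (hC : IsChargedCov C) {c : 𝕜} (hc : ‖c‖ ≤ 1)
    (htp : ∀ x y : X, twoPoint C x y = if x = y then c else 0) :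
    ∀ T : Finset (X ⊕ₗ X), ‖gaussExpect 𝕜 C (grassmannBasis 𝕜 (X ⊕ₗ X) T)‖ ≤ 1 :=
  fun T => norm_gaussExpect_grassmannBasis_le_one hC hc htp T

end UnitGaussian

end QED3TorusI

end Literature.MathematicalPhysics.QuantumFieldTheory.Dimock2011to13

end
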